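import Summits.NavierStokesRegularity.NavierStokesRegularity.Theorems.ArgmaxDoorsDepletionTools
import HarnessLib

/-!
# ArgmaxDoorsDepletionIntegrand — door family S35 «ArgmaxDoors», tools for plate D «PointDepletion» (2/2)

S-door lane helper (ns-sfl-p1 g5; texts of record nsreg-p1 g29 ROUND-33 `r33/Sketch35.lean` v3 sha16
93168f45ce53c5c4 = tree P0 `Theorems/ArgmaxDoorsDefs.lean` p645080; `--supports stmt-NavierStokesRegularity-0056
--as helper`). Second tools file for plate D (door C only):

* `norm_sub_inner_smul_le`, `sub_inner_smul_sub`, `self_sub_inner_vorticityDirection_smul` — the projection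
  `w ↦ w − ⟪w, ξ⟫ξ` orthogonal to a vector of norm `≤ 1` does not increase norms, is additive, and kills `ω(x₀)`
  when `ξ = ω(x₀)/|ω(x₀)|`;
* `integrable_depletionIntegrand` — **the depletion integrand `y ↦ ‖ω(y) − ⟪ω(y), ξ⟫ξ‖ |x₀ − y|⁻³` is
  integrable** for `ω ∈ C¹` with `∫‖ω‖² < ∞` (near `x₀`: mean value inequality on `B(x₀,1)` gives `≤ L|x₀−y|⁻²`,
  the tree's `kernelMajorant`; far: `ab ≤ (a²+b²)/2` with `∫_{|z|≥1}|z|⁻⁶ < ∞`);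
* `integrable_norm_mul_farCube`, `tendsto_integral_norm_mul_farCube` — the tail
  `∫_{|x₀−y| ≥ n+1} ‖ω(y)‖ |x₀ − y|⁻³ dy` is finite and tends to `0` (dominated convergence).

WHAT THIS IS NOT: kernel calculus for a regularity CRITERION (door S35-C) about hypothetical blow-up; item 0056
`NoTypeII` and NS regularity are NOT proved; nothing here is a route or a summit statement.
-/

-- the summit's problem namespace repeats the summit name (tree layout)
set_option linter.dupNamespace false

noncomputable section

open MeasureTheory Set Function Filter Metric Real InnerProductSpace
open scoped ENNReal NNReal RealInnerProductSpace Topology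

namespace Summit.NavierStokesRegularity.NavierStokesRegularity.Theorems.ArgmaxDoors

open Literature.Analysis.FluidPDE

/-! ### The projection orthogonal to a short vector does not increase norms -/

/-- For `‖e‖ ≤ 1`: `‖w − ⟪w, e⟫ e‖ ≤ ‖w‖` (`‖w − ⟪w,e⟫e‖² = ‖w‖² − ⟪w,e⟫²(2 − ‖e‖²)`). -/
theorem norm_sub_inner_smul_le {e : EuclideanSpace ℝ (Fin 3)} (he : ‖e‖ ≤ 1)
    (w : EuclideanSpace ℝ (Fin 3)) : ‖w - ⟪w, e⟫ • e‖ ≤ ‖w‖ := by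
  have h0 : 0 ≤ ‖w - ⟪w, e⟫ • e‖ := norm_nonneg _
  have h1 : ‖w - ⟪w, e⟫ • e‖ ^ 2 = ‖w‖ ^ 2 - ⟪w, e⟫ ^ 2 * (2 - ‖e‖ ^ 2) := by
    rw [@norm_sub_sq_real, real_inner_smul_right, norm_smul, Real.norm_eq_abs, mul_pow, sq_abs]
    ring
  have h2 : ‖w - ⟪w, e⟫ • e‖ ^ 2 ≤ ‖w‖ ^ 2 := by
    rw [h1]
    have he2 : ‖e‖ ^ 2 ≤ 1 := by
      have := mul_le_mul he he (norm_nonneg e) zero_le_one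
      nlinarith
    nlinarith [sq_nonneg ⟪w, e⟫]
  exact (pow_le_pow_iff_left₀ h0 (norm_nonneg w) two_ne_zero).1 h2

/-- The projection is additive: `(w₁ − ⟪w₁,e⟫e) − (w₂ − ⟪w₂,e⟫e) = (w₁ − w₂) − ⟪w₁ − w₂, e⟫e`. -/
theorem sub_inner_smul_sub (e w₁ w₂ : EuclideanSpace ℝ (Fin 3)) :
    (w₁ - ⟪w₁, e⟫ • e) - (w₂ - ⟪w₂, e⟫ • e) = (w₁ - w₂) - ⟪w₁ - w₂, e⟫ • e := by
  rw [inner_sub_left, sub_smul]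
  abel

/-- The projection orthogonal to the direction of `ω(x₀)` kills `ω(x₀)`:
`ω(x₀) − ⟪ω(x₀), ξ⟫ξ = 0`, `ξ = vorticityDirection ω x₀` (junk-free: both sides vanish if `ω(x₀) = 0`). -/
theorem self_sub_inner_vorticityDirection_smul (w : EuclideanSpace ℝ (Fin 3) → EuclideanSpace ℝ (Fin 3))
    (x₀ : EuclideanSpace ℝ (Fin 3)) :
    w x₀ - ⟪w x₀, vorticityDirection w x₀⟫ • vorticityDirection w x₀ = 0 := by
  by_cases hx : w x₀ = 0
  · simp [hx]
  · have he : ‖vorticityDirection w x₀‖ = 1 := norm_vorticityDirection w hx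
    have hsm : ‖w x₀‖ • vorticityDirection w x₀ = w x₀ := by
      rw [vorticityDirection_apply, smul_smul, mul_inv_cancel₀ (norm_ne_zero_iff.2 hx), one_smul]
    conv_lhs => rw [← hsm]
    rw [real_inner_smul_left, real_inner_self_eq_norm_sq, he, one_pow, mul_one, sub_self]

/-! ### Integrability of the depletion integrand -/

/-- **The depletion integrand is integrable.** For `ω ∈ C¹(ℝ³; ℝ³)` with `∫‖ω‖² < ∞` and any `x₀`, the function
`y ↦ ‖ω(y) − ⟪ω(y), ξ⟫ξ‖ · |x₀ − y|⁻³`, `ξ = ω(x₀)/|ω(x₀)|`, is integrable: on `B(x₀,1)` the numerator is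
`≤ ‖ω(y) − ω(x₀)‖ ≤ L|y − x₀|` (the projection kills `ω(x₀)`; mean value inequality with `L = sup_{B̄(x₀,1)}‖∇ω‖`),
so the integrand is `≤ L|x₀ − y|⁻²` (`kernelMajorant`); off the ball it is `≤ ‖ω(y)‖|x₀ − y|⁻³ ≤ (‖ω(y)‖² +
|x₀ − y|⁻⁶)/2`. -/
theorem integrable_depletionIntegrand {w : EuclideanSpace ℝ (Fin 3) → EuclideanSpace ℝ (Fin 3)}
    (hw : ContDiff ℝ 1 w) (hw2 : Integrable fun y => ‖w y‖ ^ 2) (x₀ : EuclideanSpace ℝ (Fin 3)) :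
    Integrable fun y => ‖w y - ⟪w y, vorticityDirection w x₀⟫ • vorticityDirection w x₀‖ *
      (‖x₀ - y‖ ^ 3)⁻¹ := by
  -- the projection kills `ω x₀`; then make the direction a genuine variable (no `set`: keeps `whnf` cheap)
  have h0 : w x₀ - ⟪w x₀, vorticityDirection w x₀⟫ • vorticityDirection w x₀ = 0 :=
    self_sub_inner_vorticityDirection_smul w x₀
  have he1 : ‖vorticityDirection w x₀‖ ≤ 1 := by
    by_cases hx : w x₀ = 0
    · rw [(vorticityDirection_eq_zero_iff w x₀).2 hx, norm_zero]; exact zero_le_one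
    · exact (norm_vorticityDirection w hx).le
  generalize vorticityDirection w x₀ = e at h0 he1 ⊢
  have hwc : Continuous w := hw.continuous
  have hwd : ∀ y, DifferentiableAt ℝ w y := fun y => (hw.differentiable one_ne_zero) y
  -- a bound for `∇ω` on the closed unit ball about `x₀`
  obtain ⟨L, hL⟩ := (isCompact_closedBall x₀ 1).exists_bound_of_continuousOn
    ((hw.continuous_fderiv one_ne_zero).continuousOn)
  have hL0 : 0 ≤ L := (norm_nonneg _).trans (hL x₀ (mem_closedBall_self zero_le_one))
  -- mean value: `‖ω y − ω x₀‖ ≤ L ‖y − x₀‖` on the ball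
  have hmv : ∀ y ∈ ball x₀ 1, ‖w y - w x₀‖ ≤ L * ‖y - x₀‖ := fun y hy =>
    (convex_ball x₀ 1).norm_image_sub_le_of_norm_fderiv_le (fun z _ => hwd z)
      (fun z hz => hL z (ball_subset_closedBall hz)) (mem_ball_self one_pos) hy
  -- the numerator: `‖P(ω y)‖ ≤ ‖ω y − ω x₀‖` and `≤ ‖ω y‖`
  have hnum1 : ∀ y, ‖w y - ⟪w y, e⟫ • e‖ ≤ ‖w y - w x₀‖ := by
    intro y
    calc ‖w y - ⟪w y, e⟫ • e‖ = ‖(w y - ⟪w y, e⟫ • e) - (w x₀ - ⟪w x₀, e⟫ • e)‖ := by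
          rw [h0, sub_zero]
      _ = ‖(w y - w x₀) - ⟪w y - w x₀, e⟫ • e‖ := by rw [sub_inner_smul_sub]
      _ ≤ ‖w y - w x₀‖ := norm_sub_inner_smul_le he1 _
  have hnum2 : ∀ y, ‖w y - ⟪w y, e⟫ • e‖ ≤ ‖w y‖ := fun y => norm_sub_inner_smul_le he1 _
  -- the far kernel `1_{|z| ≥ 1}|z|⁻³` and the dominating function
  obtain ⟨kf, hkf⟩ : ∃ kf : EuclideanSpace ℝ (Fin 3) → ℝ, kf = fun z =>
      (ball (0 : EuclideanSpace ℝ (Fin 3)) 1)ᶜ.indicator (fun z => (‖z‖ ^ 3)⁻¹) z := ⟨_, rfl⟩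
  have hkf2 : Integrable fun y => kf (x₀ - y) ^ 2 := by
    rw [hkf]; exact integrable_sq_farKernel (by norm_num) one_pos x₀
  have hkf0 : ∀ z, 0 ≤ kf z := fun z => by rw [hkf]; exact farKernel_nonneg 3 1 z
  have hg : Integrable fun y => L * kernelMajorant 1 (x₀ - y) + (‖w y‖ ^ 2 + kf (x₀ - y) ^ 2) / 2 :=
    (((integrable_kernelMajorant 1).comp_sub_left x₀).const_mul L).add ((hw2.add hkf2).div_const 2)
  have hmeas : AEStronglyMeasurable
      (fun y => ‖w y - ⟪w y, e⟫ • e‖ * (‖x₀ - y‖ ^ 3)⁻¹) volume := by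
    have hci : Continuous fun y => ⟪w y, e⟫ := Continuous.inner (𝕜 := ℝ) hwc continuous_const
    have hc1 : Continuous fun y => ‖w y - ⟪w y, e⟫ • e‖ :=
      (hwc.sub (hci.smul continuous_const)).norm
    have hc2 : Continuous fun y : EuclideanSpace ℝ (Fin 3) => ‖x₀ - y‖ ^ 3 :=
      (continuous_const.sub continuous_id).norm.pow 3
    have hm2 : Measurable fun y : EuclideanSpace ℝ (Fin 3) => (‖x₀ - y‖ ^ 3)⁻¹ := hc2.measurable.inv
    exact (hc1.measurable.mul hm2).aestronglyMeasurable
  refine hg.mono' hmeas (Eventually.of_forall fun y => ?_)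
  rw [Real.norm_of_nonneg (by positivity)]
  have hnear0 : 0 ≤ L * kernelMajorant 1 (x₀ - y) := mul_nonneg hL0 (kernelMajorant_nonneg _ _)
  have hfar0 : 0 ≤ (‖w y‖ ^ 2 + kf (x₀ - y) ^ 2) / 2 := by positivity
  by_cases hy : ‖x₀ - y‖ < 1
  · -- near: `≤ L |x₀ − y|⁻²`
    by_cases hyx : y = x₀
    · subst hyx
      rw [h0, norm_zero, zero_mul]
      exact add_nonneg hnear0 hfar0
    · have hpos : 0 < ‖x₀ - y‖ := norm_pos_iff.2 (sub_ne_zero.2 (Ne.symm hyx))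
      have hmem : x₀ - y ∈ ball (0 : EuclideanSpace ℝ (Fin 3)) 1 := by rwa [mem_ball_zero_iff]
      have hk : kernelMajorant 1 (x₀ - y) = (‖x₀ - y‖ ^ 2)⁻¹ := by
        rw [kernelMajorant, indicator_of_mem hmem]
      have hyb : y ∈ ball x₀ 1 := by rw [mem_ball, dist_eq_norm, norm_sub_rev]; exact hy
      have h1 : ‖w y - ⟪w y, e⟫ • e‖ ≤ L * ‖x₀ - y‖ := by
        rw [norm_sub_rev x₀ y]; exact (hnum1 y).trans (hmv y hyb)
      calc ‖w y - ⟪w y, e⟫ • e‖ * (‖x₀ - y‖ ^ 3)⁻¹ ≤ (L * ‖x₀ - y‖) * (‖x₀ - y‖ ^ 3)⁻¹ :=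
            mul_le_mul_of_nonneg_right h1 (by positivity)
        _ = L * kernelMajorant 1 (x₀ - y) := by
            rw [hk]; field_simp
        _ ≤ L * kernelMajorant 1 (x₀ - y) + (‖w y‖ ^ 2 + kf (x₀ - y) ^ 2) / 2 := by linarith
  · -- far: `≤ ‖ω y‖ |x₀ − y|⁻³ ≤ (‖ω y‖² + |x₀−y|⁻⁶)/2`
    rw [not_lt] at hy
    have hk : kf (x₀ - y) = (‖x₀ - y‖ ^ 3)⁻¹ := by rw [hkf]; exact farKernel_eq_of_le hy
    have hamgm : ‖w y‖ * (‖x₀ - y‖ ^ 3)⁻¹ ≤ (‖w y‖ ^ 2 + kf (x₀ - y) ^ 2) / 2 := by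
      rw [← hk]
      nlinarith [sq_nonneg (‖w y‖ - kf (x₀ - y))]
    calc ‖w y - ⟪w y, e⟫ • e‖ * (‖x₀ - y‖ ^ 3)⁻¹ ≤ ‖w y‖ * (‖x₀ - y‖ ^ 3)⁻¹ :=
          mul_le_mul_of_nonneg_right (hnum2 y) (by positivity)
      _ ≤ (‖w y‖ ^ 2 + kf (x₀ - y) ^ 2) / 2 := hamgm
      _ ≤ L * kernelMajorant 1 (x₀ - y) + (‖w y‖ ^ 2 + kf (x₀ - y) ^ 2) / 2 := by linarith

/-! ### The far tail of `‖ω‖ |x₀ − ·|⁻³` tends to zero -/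

/-- `y ↦ ‖ω(y)‖ 1_{|x₀−y| ≥ R}|x₀ − y|⁻³` is integrable for continuous `ω` with `∫‖ω‖² < ∞`, `R > 0`
(product of two `L²` functions). -/
theorem integrable_norm_mul_farCube {w : EuclideanSpace ℝ (Fin 3) → EuclideanSpace ℝ (Fin 3)}
    (hwc : Continuous w) (hw2 : Integrable fun y => ‖w y‖ ^ 2) (x₀ : EuclideanSpace ℝ (Fin 3))
    {R : ℝ} (hR : 0 < R) :
    Integrable fun y => ‖w y‖ *
      (ball (0 : EuclideanSpace ℝ (Fin 3)) R)ᶜ.indicator (fun z => (‖z‖ ^ 3)⁻¹) (x₀ - y) := by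
  refine integrable_of_norm_le_mul_sq ?_ (a := fun y => ‖w y‖)
    (b := fun y => (ball (0 : EuclideanSpace ℝ (Fin 3)) R)ᶜ.indicator (fun z => (‖z‖ ^ 3)⁻¹) (x₀ - y))
    hw2 (integrable_sq_farKernel (by norm_num) hR x₀) fun y => ?_
  · exact (hwc.norm.measurable.mul (measurable_farKernel_sub 3 R x₀)).aestronglyMeasurable
  · rw [Real.norm_of_nonneg (mul_nonneg (norm_nonneg _) (farKernel_nonneg 3 R _))]

/-- **The tail vanishes**: `∫ ‖ω(y)‖ 1_{|x₀−y| ≥ n+1}|x₀ − y|⁻³ dy → 0` as `n → ∞` (dominated convergence: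
pointwise the indicator is eventually `0`, domination by the `n = 0` integrand). -/
theorem tendsto_integral_norm_mul_farCube {w : EuclideanSpace ℝ (Fin 3) → EuclideanSpace ℝ (Fin 3)}
    (hwc : Continuous w) (hw2 : Integrable fun y => ‖w y‖ ^ 2) (x₀ : EuclideanSpace ℝ (Fin 3)) :
    Tendsto (fun n : ℕ => ∫ y, ‖w y‖ *
      (ball (0 : EuclideanSpace ℝ (Fin 3)) ((n : ℝ) + 1))ᶜ.indicator (fun z => (‖z‖ ^ 3)⁻¹) (x₀ - y))
      atTop (𝓝 0) := by
  have hbound := integrable_norm_mul_farCube hwc hw2 x₀ one_pos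
  have h := tendsto_integral_of_dominated_convergence
    (F := fun (n : ℕ) y => ‖w y‖ *
      (ball (0 : EuclideanSpace ℝ (Fin 3)) ((n : ℝ) + 1))ᶜ.indicator (fun z => (‖z‖ ^ 3)⁻¹) (x₀ - y))
    (f := fun _ => (0 : ℝ))
    (fun y => ‖w y‖ * (ball (0 : EuclideanSpace ℝ (Fin 3)) 1)ᶜ.indicator (fun z => (‖z‖ ^ 3)⁻¹) (x₀ - y))
    (fun n => (hwc.norm.measurable.mul (measurable_farKernel_sub 3 _ x₀)).aestronglyMeasurable)
    hbound ?_ ?_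
  · simpa using h
  · intro n
    refine Eventually.of_forall fun y => ?_
    have hn : (1 : ℝ) ≤ (n : ℝ) + 1 := by
      have : (0 : ℝ) ≤ n := Nat.cast_nonneg n
      linarith
    rw [Real.norm_of_nonneg (mul_nonneg (norm_nonneg _) (farKernel_nonneg 3 _ _))]
    refine mul_le_mul_of_nonneg_left ?_ (norm_nonneg _)
    refine indicator_le_indicator_of_subset (compl_subset_compl.2 (ball_subset_ball hn))
      (fun z => by positivity) _
  · refine Eventually.of_forall fun y => ?_
    apply tendsto_const_nhds.congr'
    obtain ⟨N, hN⟩ := exists_nat_gt ‖x₀ - y‖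
    filter_upwards [eventually_ge_atTop N] with n hn
    have hmem : x₀ - y ∉ (ball (0 : EuclideanSpace ℝ (Fin 3)) ((n : ℝ) + 1))ᶜ := by
      rw [mem_compl_iff, not_not, mem_ball_zero_iff]
      have : (N : ℝ) ≤ n := by exact_mod_cast hn
      linarith
    rw [indicator_of_notMem hmem, mul_zero]

end Summit.NavierStokesRegularity.NavierStokesRegularity.Theorems.ArgmaxDoors

end
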